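import Summits.ABC.ABC.Theses.IsogenyGlueCongruence
import Literature.NumberTheory.Automorphic.ShimuraCurveRibetTakahashiOptimalProofs
import Literature.NumberTheory.Automorphic.ShimuraCurveRibetTakahashiSemistableManinProofs

/-!
# The class-optimal datum lives on a globally minimal semistable model of conductor `N`
# (crux `PolyDegreeOfBoundedPrimes`, stmt-ABC-2046, line `Sketch`, stub `stub_optimalDatumSemistable`)

Granted Edixhoven's Prop. 2 in lattice form (`hEd`: a globally minimal elliptic `W'/ℚ` with newform
`f ∈ S₂(Γ₀(N))` whose Néron-type lattice is exactly `q Λ_f`, `q ∈ ℚ`, has `q ∈ ℤ`), every datum `D`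
of an elliptic `W/ℚ` at a SQUARE-FREE level `N` yields a globally minimal elliptic `W₀/ℚ` carrying a
lattice-optimal datum `D₀` (`Λ_{W₀} = c₀ Λ_f`) with the same newform `D₀.f = D.f`, of minimal
degree among all data at level `N` with that newform — the tree theorem
`ModularParametrizationData.exists_optimalDatum_of_edixhoven` — and `W₀` is SEMISTABLE with
conductor `N_{W₀} = N` by Carayol's level theorem at square-free level (tree theorems
`IsNewformOf.isSemistable_of_squarefree_level`, `IsNewformOf.level_eq_conductorNorm_of_squarefree_level`,
applied to `D₀.isNewformOf`). Supports stmt-ABC-2046.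
-/

noncomputable section

-- single-conjunct summit ABC: the duplicate ABC.ABC is mandated (CONVENTIONS §2)
set_option linter.dupNamespace false

namespace Summit.ABC.ABC.Theorems

open Literature.NumberTheory.EllipticCurves Literature.NumberTheory.EllipticCurves.ModularForms
  CongruenceSubgroup

/-- **The class-optimal datum on a globally minimal SEMISTABLE model of conductor `N`.** Granted
Edixhoven's Prop. 2 in lattice form (hypothesis `hEd`, Edixhoven 1991, Prop. 2: the Manin constant
of the strong Weil curve is an integer), every datum `D` of an elliptic `W/ℚ` at a square-free
level `N` yields a globally minimal elliptic `W₀/ℚ`, semistable with `N_{W₀} = N`, carrying a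
lattice-optimal datum `D₀` (`Λ_{W₀} = c₀ Λ_f`) with the same newform `D₀.f = D.f`, of minimal degree
among all data at level `N` with that newform: `exists_optimalDatum_of_edixhoven` supplies
`W₀, D₀` (the isogeny `W ~ W₀` is discarded), and since `D₀.f ∈ S₂(Γ₀(N))` is the newform of `W₀`
with `N` squarefree, Carayol's level theorem at square-free level gives `N = N_{W₀}` and the
semistability of `W₀` (`IsNewformOf.level_eq_conductorNorm_of_squarefree_level`,
`IsNewformOf.isSemistable_of_squarefree_level`). [cite: EdixhovenManin1991, Prop. 2]
[cite: DiamondShurman2005, Thm. 8.8.1] -/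
theorem stub_optimalDatumSemistable : (∀ {N : ℕ} [NeZero N] {W' : WeierstrassCurve ℚ} [W'.IsElliptic] [W'.IsGloballyMinimal] {f : CuspForm (CongruenceSubgroup.Gamma0 N) 2} {L' : PeriodPair}, Literature.NumberTheory.EllipticCurves.ModularForms.IsNewformOf W' f → Literature.NumberTheory.EllipticCurves.ModularForms.IsNeronLatticeOf (W'.baseChange ℂ) L' → ∀ q : ℚ, (∀ z ∈ Literature.NumberTheory.EllipticCurves.ModularForms.periodLattice f, (q : ℂ) * z ∈ L'.lattice) → (∀ z ∈ L'.lattice, ∃ w ∈ Literature.NumberTheory.EllipticCurves.ModularForms.periodLattice f, z = q * w) → ∃ k : ℤ, (k : ℚ) = q) → ∀ (N : ℕ) [NeZero N] (W : WeierstrassCurve ℚ) [W.IsElliptic] (D : Literature.NumberTheory.EllipticCurves.ModularForms.ModularParametrizationData W N), Squarefree N → ∃ (W₀ : WeierstrassCurve ℚ) (_ : W₀.IsElliptic) (_ : W₀.IsGloballyMinimal) (D₀ : Literature.NumberTheory.EllipticCurves.ModularForms.ModularParametrizationData W₀ N), D₀.f = D.f ∧ W₀.IsSemistable ℤ ∧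 W₀.conductorNorm ℤ = N ∧ (∀ z ∈ D₀.L.lattice, ∃ w ∈ Literature.NumberTheory.EllipticCurves.ModularForms.periodLattice D₀.f, z = D₀.c * w) ∧ ∀ (W₂ : WeierstrassCurve ℚ) [W₂.IsElliptic] (D₂ : Literature.NumberTheory.EllipticCurves.ModularForms.ModularParametrizationData W₂ N), D₂.f = D₀.f → D₀.modularDegree ≤ D₂.modularDegree := by
  intro hEd N _ W _ D hsq
  -- the class-optimal datum on a globally minimal model (Edixhoven's Prop. 2)
  obtain ⟨W₀, hW₀, hW₀', D₀, hf, -, hopt, hmin⟩ :=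
    ModularParametrizationData.exists_optimalDatum_of_edixhoven hEd D
  haveI := hW₀
  -- Carayol at square-free level: `W₀` is semistable of conductor `N`
  have hss₀ : W₀.IsSemistable ℤ := D₀.isNewformOf.isSemistable_of_squarefree_level hsq
  have hN₀ : N = W₀.conductorNorm ℤ := D₀.isNewformOf.level_eq_conductorNorm_of_squarefree_level hsq
  exact ⟨W₀, hW₀, hW₀', D₀, hf, hss₀, hN₀.symm, hopt, hmin⟩

end Summit.ABC.ABC.Theorems

end
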